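import Mathlib
import Literature.MathematicalPhysics.QuantumFieldTheory.PointwiseOSReconstruction
import Literature.MathematicalPhysics.QuantumFieldTheory.MirrorRPKernel
import HarnessLib

/-!
# Translating the part of a configuration above a mirror: holomorphy in the normal parameter

Topic `Literature/MathematicalPhysics/QuantumFieldTheory`.  Let `S : CorrFamily d` be a permutation
symmetric, translation invariant correlation family and `n ≠ 0` a normal vector such that the
two-cluster functions of the mirror `n^⊥` are holomorphic in the normal translation of the second
cluster — the `y = 0` section of the in-plane light cone, i.e. the Osterwalder–Schrader statement
that `t ↦ ⟪ψ_A, e^{-tH} ψ_B⟫` is holomorphic on `{Re t > 0}` and bounded by `‖ψ_A‖ ‖ψ_B‖`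
(Glimm–Jaffe Thm. 6.1.3; written out as the hypothesis `hH` below, cluster by cluster, with the
Gram bound `‖Φ‖² ≤ S(θA ⊔ A) S(θB ⊔ B)`).

* `exists_perm_append_of_finset` — re-indexing `Fin (k + k') ≃ Fin N` that lists the complement of
  a finite index set `J` first and `J` last.
* `exists_halfPlane_extension_slabShift` — **the one-mirror lemma**: if the points `z i`, `i ∉ J`,
  lie strictly below the height `h₀` along `n` and the points `z i`, `i ∈ J`, strictly above
  `h₀ + t₀‖n‖²`, then `r ↦ S N (z + r·1_J n)` (translate only the `J`-part along `n`) is the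
  restriction to `(-t₀, ∞)` of a function holomorphic on the half-plane `{Re r > -t₀}`, with the
  Gram bound (a mirror at height `h₀`; translation invariance moves it to the origin, permutation
  symmetry sorts the configuration into the two clusters).
* `eventually_exists_halfPlane_extension_slabShift` — the same with a bound `M` and a half-plane
  UNIFORM over all configurations near an injective `z₀` (continuity of `S` off the diagonals makes
  the two Gram factors locally bounded).

NOT here: the light cone itself, lattice normals, analyticity in a point (see the local cross
theorem `Literature/Analysis/Complex/LocalCrossTheorem.lean`).

## References
* J. Glimm, A. Jaffe, *Quantum Physics* (2nd ed. 1987), §6.1 Thm. 6.1.3. [GlimmJaffe1987]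
* K. Osterwalder, R. Schrader, Comm. Math. Phys. 31 (1973), §4.1. [OsterwalderSchrader1973]
-/

noncomputable section

open scoped InnerProductSpace BigOperators
open Literature.Probability.LatticeModels _root_.Filter _root_.Set
open scoped _root_.Topology

namespace Literature.MathematicalPhysics.QuantumFieldTheory

variable {d : ℕ}

/-! ### Re-indexing a configuration into the two clusters of a mirror -/

/-- `Fin.append u v` is injective when `u`, `v` are injective with disjoint ranges. [folklore] -/
theorem injective_fin_append {α : Type*} {m k : ℕ} {u : Fin m → α} {v : Fin k → α}
    (hu : Function.Injective u) (hv : Function.Injective v) (huv : ∀ i j, u i ≠ v j) :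
    Function.Injective (Fin.append u v) := by
  intro i j h
  induction i using Fin.addCases with
  | left i =>
    induction j using Fin.addCases with
    | left j =>
      simp only [Fin.append_left] at h
      rw [hu h]
    | right j =>
      simp only [Fin.append_left, Fin.append_right] at h
      exact absurd h (huv i j)
  | right i =>
    induction j using Fin.addCases with
    | left j =>
      simp only [Fin.append_left, Fin.append_right] at h
      exact absurd h.symm (huv j i)
    | right j =>
      simp only [Fin.append_right] at h
      rw [hv h]

/-- **Re-indexing by a finite index set.** For `J ⊆ Fin N` there are enumerations `eL` of the
complement of `J` and `eU` of `J` and a bijection `σ : Fin (k + k') ≃ Fin N` with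
`w ∘ σ = Fin.append (w ∘ eL) (w ∘ eU)` for every configuration `w`. [folklore] -/
theorem exists_perm_append_of_finset {α : Type*} {N : ℕ} (J : Finset (Fin N)) :
    ∃ (k k' : ℕ) (eL : Fin k → Fin N) (eU : Fin k' → Fin N) (σ : Fin (k + k') ≃ Fin N),
      (∀ a, eL a ∉ J) ∧ (∀ b, eU b ∈ J) ∧ Function.Injective eL ∧ Function.Injective eU ∧
      ∀ w : Fin N → α, w ∘ σ = Fin.append (w ∘ eL) (w ∘ eU) := by
  classical
  set fL : Fin (Fintype.card {i : Fin N // i ∉ J}) ≃ {i : Fin N // i ∉ J} :=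
    (Fintype.equivFin _).symm
  set fU : Fin (Fintype.card {i : Fin N // i ∈ J}) ≃ {i : Fin N // i ∈ J} :=
    (Fintype.equivFin _).symm
  set σ : Fin (Fintype.card {i : Fin N // i ∉ J} + Fintype.card {i : Fin N // i ∈ J}) ≃ Fin N :=
    finSumFinEquiv.symm.trans ((fL.sumCongr fU).trans
      ((Equiv.sumComm _ _).trans (Equiv.sumCompl fun i : Fin N => i ∈ J)))
  refine ⟨_, _, fun a => (fL a).1, fun b => (fU b).1, σ, fun a => (fL a).2, fun b => (fU b).2,
    fun a a' h => fL.injective (Subtype.ext h), fun b b' h => fU.injective (Subtype.ext h),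
    fun w => ?_⟩
  ext i
  induction i using Fin.addCases with
  | left a => simp [σ]
  | right b => simp [σ]

/-! ### The one-mirror lemma -/

variable {S : CorrFamily d} {n : EuclideanSpace ℝ (Fin d)}

/-- The point `p₀ = (h₀/‖n‖²) n` of the normal line has height `⟪p₀, n⟫ = h₀`. [folklore] -/
theorem inner_heightPoint (hn : n ≠ 0) (h₀ : ℝ) : ⟪(h₀ / ‖n‖ ^ 2) • n, n⟫_ℝ = h₀ := by
  rw [real_inner_smul_left, real_inner_self_eq_norm_sq]
  have : ‖n‖ ≠ 0 := norm_ne_zero_iff.2 hn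
  field_simp

/-- **The one-mirror lemma (given a re-indexing).** Let `S` be permutation symmetric and
translation invariant, with two-cluster functions of the mirror `n^⊥` holomorphic in the normal
translation of the second cluster (hypothesis `hH`: Glimm–Jaffe Thm. 6.1.3 at one point of the
mirror plane, with the Gram bound). If the points `z i`, `i ∉ J`, have heights `⟪z i, n⟫ < h₀` and
the points `z i`, `i ∈ J`, heights `> h₀ + t₀‖n‖²` (`t₀ > 0`), then `r ↦ S N (z + r·1_J n)` is on
`(-t₀, ∞)` the restriction of a function holomorphic on `{Re r > -t₀}` whose modulus squared is
(for `t₀ > 0`; vacuous domain conventions otherwise)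
bounded by the product of the two Gram values `S(θA ⊔ A) · S(θB ⊔ B)` of the lower cluster
`A = θ(z|_{Jᶜ} - p₀)` and the upper cluster `B = z|_J - p₀ - t₀ n` (`⟪p₀, n⟫ = h₀`).
[cite: GlimmJaffe1987, §6.1 Thm. 6.1.3] -/
theorem exists_halfPlane_extension_slabShift_of_reindex (hn : n ≠ 0)
    (hP : IsPermutationSymmetric S) (hT : IsTranslationInvariant S)
    (hH : ∀ (k : ℕ) (A : Fin k → EuclideanSpace ℝ (Fin d)) (k' : ℕ)
      (B : Fin k' → EuclideanSpace ℝ (Fin d)), (∀ a, 0 < ⟪A a, n⟫_ℝ) → (∀ b, 0 < ⟪B b, n⟫_ℝ) →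
      ∃ Φ : ℂ → ℂ, DifferentiableOn ℂ Φ {t : ℂ | 0 < t.re} ∧
        (∀ t : ℝ, 0 < t → Φ t = ((S (k + k')
          (Fin.append (fun a => (ℝ ∙ n)ᗮ.reflection (A a)) (fun b => B b + t • n)) : ℝ) : ℂ)) ∧
        ∀ t : ℂ, 0 < t.re → ‖Φ t‖ ^ 2 ≤
          S (k + k) (Fin.append (fun a => (ℝ ∙ n)ᗮ.reflection (A a)) A) *
          S (k' + k') (Fin.append (fun b => (ℝ ∙ n)ᗮ.reflection (B b)) B))
    {N k k' : ℕ} (J : Finset (Fin N)) (eL : Fin k → Fin N) (eU : Fin k' → Fin N)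
    (σ : Fin (k + k') ≃ Fin N) (heL : ∀ a, eL a ∉ J) (heU : ∀ b, eU b ∈ J)
    (hσ : ∀ w : Fin N → EuclideanSpace ℝ (Fin d), w ∘ σ = Fin.append (w ∘ eL) (w ∘ eU))
    (z : Fin N → EuclideanSpace ℝ (Fin d)) {h₀ t₀ : ℝ}
    (hlow : ∀ i ∉ J, ⟪z i, n⟫_ℝ < h₀) (hup : ∀ i ∈ J, h₀ + t₀ * ‖n‖ ^ 2 < ⟪z i, n⟫_ℝ) :
    ∃ Φ : ℂ → ℂ, DifferentiableOn ℂ Φ {r : ℂ | -t₀ < r.re} ∧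
      (∀ r : ℝ, -t₀ < r →
        Φ r = ((S N (fun i => z i + (if i ∈ J then r else 0) • n) : ℝ) : ℂ)) ∧
      ∀ r : ℂ, -t₀ < r.re → ‖Φ r‖ ^ 2 ≤
        S (k + k) (Fin.append (fun a => z (eL a) - (h₀ / ‖n‖ ^ 2) • n)
          (fun a => (ℝ ∙ n)ᗮ.reflection (z (eL a) - (h₀ / ‖n‖ ^ 2) • n))) *
        S (k' + k') (Fin.append
          (fun b => (ℝ ∙ n)ᗮ.reflection (z (eU b) - (h₀ / ‖n‖ ^ 2) • n - t₀ • n))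
          (fun b => z (eU b) - (h₀ / ‖n‖ ^ 2) • n - t₀ • n)) := by
  set p₀ : EuclideanSpace ℝ (Fin d) := (h₀ / ‖n‖ ^ 2) • n with hp₀def
  have hp₀ : ⟪p₀, n⟫_ℝ = h₀ := inner_heightPoint hn h₀
  have hnn : ⟪n, n⟫_ℝ = ‖n‖ ^ 2 := real_inner_self_eq_norm_sq n
  set A : Fin k → EuclideanSpace ℝ (Fin d) := fun a => (ℝ ∙ n)ᗮ.reflection (z (eL a) - p₀) with hA
  set B : Fin k' → EuclideanSpace ℝ (Fin d) := fun b => z (eU b) - p₀ - t₀ • n with hB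
  have hApos : ∀ a, 0 < ⟪A a, n⟫_ℝ := fun a => by
    rw [hA]; dsimp only
    rw [inner_mirrorReflection_normal, inner_sub_left, hp₀]
    linarith [hlow (eL a) (heL a)]
  have hBpos : ∀ b, 0 < ⟪B b, n⟫_ℝ := fun b => by
    rw [hB]; dsimp only
    rw [inner_sub_left, inner_sub_left, hp₀, real_inner_smul_left, hnn]
    linarith [hup (eU b) (heU b)]
  obtain ⟨Φ₀, hd, hr, hb⟩ := hH k A k' B hApos hBpos
  have hreflA : ∀ a, (ℝ ∙ n)ᗮ.reflection (A a) = z (eL a) - p₀ := fun a =>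
    Submodule.reflection_reflection _ _
  refine ⟨fun r => Φ₀ (r + t₀), ?_, fun r hr' => ?_, fun r hr' => ?_⟩
  · refine hd.comp (differentiableOn_id.add_const _) fun r hr' => ?_
    simp only [mem_setOf_eq, Complex.add_re, Complex.ofReal_re] at hr' ⊢
    linarith
  · -- the configuration identity
    have hpos : 0 < r + t₀ := by linarith
    have e1 : ((r : ℂ) + (t₀ : ℂ)) = ((r + t₀ : ℝ) : ℂ) := by push_cast; ring
    show Φ₀ (r + t₀) = _
    rw [e1, hr _ hpos]
    congr 1
    -- move the mirror to the origin and sort the configuration into the two clusters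
    rw [← hT N (-p₀) (fun i => z i + (if i ∈ J then r else 0) • n), ← hP.comp_equiv σ, hσ]
    refine congrArg (S (k + k')) (funext fun i => ?_)
    induction i using Fin.addCases with
    | left a =>
      rw [Fin.append_left, Fin.append_left, Function.comp_apply, if_neg (heL a), zero_smul,
        add_zero, hreflA, sub_eq_add_neg]
    | right b =>
      rw [Fin.append_right, Fin.append_right, Function.comp_apply, if_pos (heU b), hB]
      dsimp only
      rw [add_smul]
      abel
  · have h := hb (r + t₀) (by
      simp only [Complex.add_re, Complex.ofReal_re]; linarith)
    simp only [hreflA] at h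
    exact h

/-- **The one-mirror lemma.** Under the hypotheses of
`exists_halfPlane_extension_slabShift_of_reindex` (without a chosen re-indexing):
`r ↦ S N (z + r·1_J n)` is on `(-t₀, ∞)` the restriction of a function holomorphic on the
half-plane `{Re r > -t₀}`. [cite: GlimmJaffe1987, §6.1 Thm. 6.1.3] -/
theorem exists_halfPlane_extension_slabShift (hn : n ≠ 0)
    (hP : IsPermutationSymmetric S) (hT : IsTranslationInvariant S)
    (hH : ∀ (k : ℕ) (A : Fin k → EuclideanSpace ℝ (Fin d)) (k' : ℕ)
      (B : Fin k' → EuclideanSpace ℝ (Fin d)), (∀ a, 0 < ⟪A a, n⟫_ℝ) → (∀ b, 0 < ⟪B b, n⟫_ℝ) →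
      ∃ Φ : ℂ → ℂ, DifferentiableOn ℂ Φ {t : ℂ | 0 < t.re} ∧
        (∀ t : ℝ, 0 < t → Φ t = ((S (k + k')
          (Fin.append (fun a => (ℝ ∙ n)ᗮ.reflection (A a)) (fun b => B b + t • n)) : ℝ) : ℂ)) ∧
        ∀ t : ℂ, 0 < t.re → ‖Φ t‖ ^ 2 ≤
          S (k + k) (Fin.append (fun a => (ℝ ∙ n)ᗮ.reflection (A a)) A) *
          S (k' + k') (Fin.append (fun b => (ℝ ∙ n)ᗮ.reflection (B b)) B))
    {N : ℕ} (J : Finset (Fin N)) (z : Fin N → EuclideanSpace ℝ (Fin d)) {h₀ t₀ : ℝ}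
    (hlow : ∀ i ∉ J, ⟪z i, n⟫_ℝ < h₀) (hup : ∀ i ∈ J, h₀ + t₀ * ‖n‖ ^ 2 < ⟪z i, n⟫_ℝ) :
    ∃ Φ : ℂ → ℂ, DifferentiableOn ℂ Φ {r : ℂ | -t₀ < r.re} ∧
      ∀ r : ℝ, -t₀ < r →
        Φ r = ((S N (fun i => z i + (if i ∈ J then r else 0) • n) : ℝ) : ℂ) := by
  obtain ⟨k, k', eL, eU, σ, heL, heU, -, -, hσ⟩ :=
    exists_perm_append_of_finset (α := EuclideanSpace ℝ (Fin d)) J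
  obtain ⟨Φ, hd, hr, -⟩ := exists_halfPlane_extension_slabShift_of_reindex hn hP hT hH J eL eU σ
    heL heU hσ z hlow hup
  exact ⟨Φ, hd, hr⟩

/-! ### Local uniformity of the bound -/

/-- The doubled lower cluster `(z|_{Jᶜ} - p₀) ⊔ θ(z|_{Jᶜ} - p₀)` depends continuously on `z`.
[folklore] -/
theorem continuous_lowerGramConfig {N k : ℕ} (eL : Fin k → Fin N) (p₀ : EuclideanSpace ℝ (Fin d)) :
    Continuous fun z : Fin N → EuclideanSpace ℝ (Fin d) =>
      Fin.append (fun a => z (eL a) - p₀) (fun a => (ℝ ∙ n)ᗮ.reflection (z (eL a) - p₀)) := by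
  refine continuous_pi fun i => ?_
  induction i using Fin.addCases with
  | left a =>
    simp only [Fin.append_left]
    exact (continuous_apply _).sub continuous_const
  | right a =>
    simp only [Fin.append_right]
    exact ((ℝ ∙ n)ᗮ.reflection).continuous.comp ((continuous_apply _).sub continuous_const)

/-- The doubled upper cluster `θ(z|_J - q₀) ⊔ (z|_J - q₀)` depends continuously on `z`.
[folklore] -/
theorem continuous_upperGramConfig {N k' : ℕ} (eU : Fin k' → Fin N) (q₀ : EuclideanSpace ℝ (Fin d)) :
    Continuous fun z : Fin N → EuclideanSpace ℝ (Fin d) =>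
      Fin.append (fun b => (ℝ ∙ n)ᗮ.reflection (z (eU b) - q₀)) (fun b => z (eU b) - q₀) := by
  refine continuous_pi fun i => ?_
  induction i using Fin.addCases with
  | left b =>
    simp only [Fin.append_left]
    exact ((ℝ ∙ n)ᗮ.reflection).continuous.comp ((continuous_apply _).sub continuous_const)
  | right b =>
    simp only [Fin.append_right]
    exact (continuous_apply _).sub continuous_const

/-- A cluster strictly on one side of the mirror together with its reflection is an injective
configuration. [folklore] -/
theorem injective_append_reflection {k : ℕ} {u : Fin k → EuclideanSpace ℝ (Fin d)}
    (hu : Function.Injective u) (hneg : ∀ a, ⟪u a, n⟫_ℝ < 0) :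
    Function.Injective (Fin.append u (fun a => (ℝ ∙ n)ᗮ.reflection (u a))) := by
  refine injective_fin_append hu (((ℝ ∙ n)ᗮ.reflection).injective.comp hu) fun i j h => ?_
  have h1 := hneg i
  have h2 : 0 < ⟪(ℝ ∙ n)ᗮ.reflection (u j), n⟫_ℝ := by
    rw [inner_mirrorReflection_normal]; linarith [hneg j]
  rw [h] at h1
  linarith

/-- The same with the reflected block first. [folklore] -/
theorem injective_reflection_append {k : ℕ} {u : Fin k → EuclideanSpace ℝ (Fin d)}
    (hu : Function.Injective u) (hpos : ∀ a, 0 < ⟪u a, n⟫_ℝ) :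
    Function.Injective (Fin.append (fun a => (ℝ ∙ n)ᗮ.reflection (u a)) u) := by
  refine injective_fin_append (((ℝ ∙ n)ᗮ.reflection).injective.comp hu) hu fun i j h => ?_
  have h1 : ⟪(ℝ ∙ n)ᗮ.reflection (u i), n⟫_ℝ < 0 := by
    rw [inner_mirrorReflection_normal]; linarith [hpos i]
  rw [h] at h1
  linarith [hpos j]

/-- **The one-mirror lemma, locally uniform form.** Let `S` be permutation symmetric, translation
invariant, continuous off the diagonals, with two-cluster functions of the mirror `n^⊥` holomorphic
in the normal translation (hypothesis `hH`). If `z₀` is injective, the points `z₀ i`, `i ∉ J`, have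
heights `< h₀` and the points `z₀ i`, `i ∈ J`, heights `> h₀ + τ` (`τ > 0`), then there are `ρ > 0`
and `M` such that for every configuration `z` near `z₀` the function `r ↦ S N (z + r·1_J n)` is on
`(-ρ, ∞)` the restriction of a function holomorphic on `{Re r > -ρ}` and bounded by `M` there.
[cite: GlimmJaffe1987, §6.1 Thm. 6.1.3] -/
theorem eventually_exists_halfPlane_extension_slabShift (hn : n ≠ 0)
    (hP : IsPermutationSymmetric S) (hT : IsTranslationInvariant S)
    (hC : ∀ k, ContinuousOn (S k) (NonCoincident d k))
    (hH : ∀ (k : ℕ) (A : Fin k → EuclideanSpace ℝ (Fin d)) (k' : ℕ)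
      (B : Fin k' → EuclideanSpace ℝ (Fin d)), (∀ a, 0 < ⟪A a, n⟫_ℝ) → (∀ b, 0 < ⟪B b, n⟫_ℝ) →
      ∃ Φ : ℂ → ℂ, DifferentiableOn ℂ Φ {t : ℂ | 0 < t.re} ∧
        (∀ t : ℝ, 0 < t → Φ t = ((S (k + k')
          (Fin.append (fun a => (ℝ ∙ n)ᗮ.reflection (A a)) (fun b => B b + t • n)) : ℝ) : ℂ)) ∧
        ∀ t : ℂ, 0 < t.re → ‖Φ t‖ ^ 2 ≤
          S (k + k) (Fin.append (fun a => (ℝ ∙ n)ᗮ.reflection (A a)) A) *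
          S (k' + k') (Fin.append (fun b => (ℝ ∙ n)ᗮ.reflection (B b)) B))
    {N : ℕ} (J : Finset (Fin N)) {z₀ : Fin N → EuclideanSpace ℝ (Fin d)}
    (hz₀ : Function.Injective z₀) {h₀ τ : ℝ} (hτ : 0 < τ)
    (hlow : ∀ i ∉ J, ⟪z₀ i, n⟫_ℝ < h₀) (hup : ∀ i ∈ J, h₀ + τ < ⟪z₀ i, n⟫_ℝ) :
    ∃ ρ > 0, ∃ M : ℝ, ∀ᶠ z in 𝓝 z₀, ∃ Φ : ℂ → ℂ, DifferentiableOn ℂ Φ {r : ℂ | -ρ < r.re} ∧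
      (∀ r : ℝ, -ρ < r →
        Φ r = ((S N (fun i => z i + (if i ∈ J then r else 0) • n) : ℝ) : ℂ)) ∧
      ∀ r : ℂ, -ρ < r.re → ‖Φ r‖ ≤ M := by
  obtain ⟨k, k', eL, eU, σ, heL, heU, hinjL, hinjU, hσ⟩ :=
    exists_perm_append_of_finset (α := EuclideanSpace ℝ (Fin d)) J
  have hn2 : 0 < ‖n‖ ^ 2 := by positivity
  set t₀ : ℝ := τ / (2 * ‖n‖ ^ 2) with ht₀def
  have ht₀ : 0 < t₀ := by positivity
  have ht₀τ : t₀ * ‖n‖ ^ 2 = τ / 2 := by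
    rw [ht₀def]; field_simp
  set p₀ : EuclideanSpace ℝ (Fin d) := (h₀ / ‖n‖ ^ 2) • n with hp₀def
  have hp₀ : ⟪p₀, n⟫_ℝ = h₀ := inner_heightPoint hn h₀
  have hnn : ⟪n, n⟫_ℝ = ‖n‖ ^ 2 := real_inner_self_eq_norm_sq n
  -- the two Gram values as functions of the configuration
  set gL : (Fin N → EuclideanSpace ℝ (Fin d)) → ℝ := fun z => S (k + k)
    (Fin.append (fun a => z (eL a) - p₀) (fun a => (ℝ ∙ n)ᗮ.reflection (z (eL a) - p₀))) with hgL
  set gU : (Fin N → EuclideanSpace ℝ (Fin d)) → ℝ := fun z => S (k' + k')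
    (Fin.append (fun b => (ℝ ∙ n)ᗮ.reflection (z (eU b) - p₀ - t₀ • n))
      (fun b => z (eU b) - p₀ - t₀ • n)) with hgU
  -- continuity of the Gram values at `z₀`
  have hgLc : ContinuousAt gL z₀ := by
    have hinj : Function.Injective (Fin.append (fun a => z₀ (eL a) - p₀)
        (fun a => (ℝ ∙ n)ᗮ.reflection (z₀ (eL a) - p₀))) := by
      refine injective_append_reflection (fun a a' h => hinjL (hz₀ (sub_left_injective h)))
        fun a => ?_
      rw [inner_sub_left, hp₀]
      linarith [hlow (eL a) (heL a)]
    have h1 := (hC (k + k)).continuousAt ((isOpen_nonCoincident d (k + k)).mem_nhds hinj)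
    exact ContinuousAt.comp (g := S (k + k)) (x := z₀)
      (f := fun z : Fin N → EuclideanSpace ℝ (Fin d) => Fin.append (fun a => z (eL a) - p₀)
        (fun a => (ℝ ∙ n)ᗮ.reflection (z (eL a) - p₀)))
      h1 (continuous_lowerGramConfig eL p₀).continuousAt
  have hgUc : ContinuousAt gU z₀ := by
    have hinj : Function.Injective (Fin.append
        (fun b => (ℝ ∙ n)ᗮ.reflection (z₀ (eU b) - p₀ - t₀ • n))
        (fun b => z₀ (eU b) - p₀ - t₀ • n)) := by
      refine injective_reflection_append
        (fun b b' h => hinjU (hz₀ (sub_left_injective (sub_left_injective h)))) fun b => ?_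
      rw [inner_sub_left, inner_sub_left, hp₀, real_inner_smul_left, hnn, ht₀τ]
      linarith [hup (eU b) (heU b)]
    have h1 := (hC (k' + k')).continuousAt ((isOpen_nonCoincident d (k' + k')).mem_nhds hinj)
    have h2 := (continuous_upperGramConfig (n := n) eU (p₀ + t₀ • n)).continuousAt (x := z₀)
    simp only [← sub_sub] at h2
    exact ContinuousAt.comp (g := S (k' + k')) (x := z₀)
      (f := fun z : Fin N → EuclideanSpace ℝ (Fin d) =>
        Fin.append (fun b => (ℝ ∙ n)ᗮ.reflection (z (eU b) - p₀ - t₀ • n))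
          (fun b => z (eU b) - p₀ - t₀ • n))
      h1 h2
  -- the neighbourhood of `z₀`
  have hev : ∀ᶠ z in 𝓝 z₀, (∀ i, (i ∉ J → ⟪z i, n⟫_ℝ < h₀) ∧ (i ∈ J → h₀ + t₀ * ‖n‖ ^ 2 < ⟪z i, n⟫_ℝ))
      ∧ dist (gL z) (gL z₀) < 1 ∧ dist (gU z) (gU z₀) < 1 := by
    refine (Filter.eventually_all.2 fun i => ?_).and
      (((Metric.tendsto_nhds.1 hgLc) 1 one_pos).and ((Metric.tendsto_nhds.1 hgUc) 1 one_pos))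
    have hci : Continuous fun z : Fin N → EuclideanSpace ℝ (Fin d) => ⟪z i, n⟫_ℝ :=
      (continuous_apply i).inner continuous_const
    refine Filter.Eventually.and ?_ ?_
    · by_cases hi : i ∈ J
      · exact Filter.Eventually.of_forall fun z h => absurd hi h
      · exact (hci.continuousAt.eventually_lt continuousAt_const (hlow i hi)).mono
          fun z hz _ => hz
    · by_cases hi : i ∈ J
      · have : h₀ + t₀ * ‖n‖ ^ 2 < ⟪z₀ i, n⟫_ℝ := by rw [ht₀τ]; linarith [hup i hi]
        exact (continuousAt_const.eventually_lt hci.continuousAt this).mono fun z hz _ => hz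
      · exact Filter.Eventually.of_forall fun z h => absurd h hi
  set M : ℝ := ( |gL z₀| + 1) * ( |gU z₀| + 1) with hMdef
  have hM1 : 1 ≤ M := by
    rw [hMdef]; nlinarith [abs_nonneg (gL z₀), abs_nonneg (gU z₀)]
  refine ⟨t₀, ht₀, M, hev.mono fun z ⟨hz, hL, hU⟩ => ?_⟩
  obtain ⟨Φ, hd, hr, hb⟩ := exists_halfPlane_extension_slabShift_of_reindex hn hP hT hH J eL eU σ
    heL heU hσ z (fun i hi => (hz i).1 hi) (fun i hi => (hz i).2 hi)
  refine ⟨Φ, hd, hr, fun r hr' => ?_⟩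
  have h := hb r hr'
  change ‖Φ r‖ ^ 2 ≤ gL z * gU z at h
  rw [Real.dist_eq] at hL hU
  have hL' : |gL z| ≤ |gL z₀| + 1 := by
    have := abs_sub_abs_le_abs_sub (gL z) (gL z₀); linarith
  have hU' : |gU z| ≤ |gU z₀| + 1 := by
    have := abs_sub_abs_le_abs_sub (gU z) (gU z₀); linarith
  have hsq : ‖Φ r‖ ^ 2 ≤ M ^ 2 := by
    calc ‖Φ r‖ ^ 2 ≤ gL z * gU z := h
      _ ≤ |gL z * gU z| := le_abs_self _
      _ = |gL z| * |gU z| := abs_mul _ _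
      _ ≤ ( |gL z₀| + 1) * ( |gU z₀| + 1) := by gcongr
      _ = M := rfl
      _ ≤ M ^ 2 := by nlinarith
  exact le_of_pow_le_pow_left₀ two_ne_zero (by linarith) hsq

end Literature.MathematicalPhysics.QuantumFieldTheory

end
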